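import Summits.QuantumFields.YangMills.Theorems.PoincareLipschitzPlanarStreamFunctionLetters
import Summits.QuantumFields.YangMills.Theorems.PoincareLipschitzPlanarStreamFunctionCauchy
import Mathlib.MeasureTheory.Function.L2Space
import HarnessLib

/-!
# Crux `BlockLipschitzL` (stmt-QuantumFields-23533) ∕ `HistoryTailL` (stmt-QuantumFields-19936), LINE 25 «CompactnessTransfer»,
# the (TM) discharge ROAD (H) «SU(2) currents ⇒ H-system ⇒ 8π quantum», brick (H) — file H3 «PLANAR STREAM FUNCTION: LIMIT LETTERS»

Cell `ym3-torus` (YM ladder rung R3 = continuum SU(2) Yang–Mills on T³ — a RUNG, NOT Clay: not d = 4, not infinite volume,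
not a mass gap); WIDTH helper seat `ym3-torus-px5` g9 (brick (H) of px19 g8's road memo `ROAD-TM-HSYSTEM-px19g8.md` §3, released
by ★w3 g15 16:02Z); `--supports stmt-QuantumFields-23533`; THEOREMS ONLY (0 `def`, 0 `sorry`, default heartbeats); imports H1
✓`…PlanarStreamFunctionLetters` and H2 ✓`…PlanarStreamFunctionCauchy` + Mathlib.

WHAT THIS FILE DOES (`E² = EuclideanSpace ℝ (Fin 2)`) — the letters the limit argument of H4 `exists_streamFunction` consumes:
* §1 components of an `L²` planar field are in `L²` and locally integrable; `‖⟪A⊥ y, ·⟫‖ = ‖A y‖`;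
* §2 `L²` triangle letters for differences of mollified components and for the dual field `a ↦ ⟪(W₀ a, W₁ a), ·⟫`;
* §3 ★ `eLpNorm_sub_normalised_potentials_le` — the Cauchy estimate: two NORMALISED potentials (mean zero on `B₁`) of the rotated
  mollified fields at kernels `ρ, ρ'` differ in `L¹(B_R)` by at most `K_R·(‖ρ ⋆ A₀ − ρ' ⋆ A₀‖₂ + ‖ρ ⋆ A₁ − ρ' ⋆ A₁‖₂)` (H2 applied to the
  difference, whose differential is the dual of the difference of the fields);
* §4 two convergence letters for `∫ g·h_j`: a bounded compactly supported weight against an `L¹_loc`-convergent sequence, and an `L²`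
  weight against an `L²`-convergent sequence (both via Mathlib `tendsto_integral_of_L1`).
HONEST SCOPE.  Measure-theoretic letters; nothing of (TM), (ZD), (C), S1″, K1, `MeanDeviationL`, `BlockLipschitzL`, `HistoryTailL` is
proved here.  YM₃ on T³ is rung R3, not Clay; YM gap NOT proved; no summit statement is proved here.

References: L. C. Evans, Partial Differential Equations (2010), §5.8.1 Thm. 1, App. C.4 [Evans2010].
-/

set_option autoImplicit false

noncomputable section

open scoped BigOperators Topology ENNReal NNReal Convolution ContDiff InnerProductSpace
open MeasureTheory Set Filter Function TopologicalSpace Metric ContinuousLinearMap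

namespace Summit.QuantumFields.YangMills.Theorems.PoincareLipschitzPlanarStreamFunctionLimitLetters

open Literature.Analysis.FunctionSpaces (IsTestFunctionOn HasWeakFDerivOn)
open Summit.QuantumFields.YangMills.Theorems.PoincareLipschitzPlanarStreamFunctionLetters
open Summit.QuantumFields.YangMills.Theorems.PoincareLipschitzPlanarStreamFunctionCauchy (eLpNorm_one_ball_le)

/-! ## §1 The components of an `L²` field -/

/-- A component of an `L²` planar field is in `L²`. [folklore] -/
theorem memLp_two_apply {A : EuclideanSpace ℝ (Fin 2) → EuclideanSpace ℝ (Fin 2)} (hAm : AEStronglyMeasurable A volume)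
    (hA2 : Integrable (fun y => ‖A y‖ ^ 2) volume) (k : Fin 2) : MemLp (fun y => A y k) 2 volume := by
  have hA : MemLp A 2 volume := (memLp_two_iff_integrable_sq_norm hAm).2 hA2
  have h := (EuclideanSpace.proj k : EuclideanSpace ℝ (Fin 2) →L[ℝ] ℝ).comp_memLp' hA
  exact h

/-- A component of an `L²` planar field is locally integrable. [folklore] -/
theorem locallyIntegrable_apply {A : EuclideanSpace ℝ (Fin 2) → EuclideanSpace ℝ (Fin 2)} (hAm : AEStronglyMeasurable A volume)
    (hA2 : Integrable (fun y => ‖A y‖ ^ 2) volume) (k : Fin 2) : LocallyIntegrable (fun y => A y k) volume :=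
  (memLp_two_apply hAm hA2 k).locallyIntegrable (by norm_num)

/-- The rotated field `A⊥ = (−A₁, A₀)` as a vector and its dual: norms and components. [folklore] -/
theorem norm_rot_eq (A : EuclideanSpace ℝ (Fin 2) → EuclideanSpace ℝ (Fin 2)) (y : EuclideanSpace ℝ (Fin 2)) :
    ‖(-(A y 1)) • EuclideanSpace.single (0 : Fin 2) (1:ℝ) + A y 0 • EuclideanSpace.single (1 : Fin 2) (1:ℝ)‖ = ‖A y‖ := by
  have h1 := norm_vec2_sq (-(A y 1)) (A y 0)
  have h2 : ‖A y‖ ^ 2 = A y 0 ^ 2 + A y 1 ^ 2 := by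
    rw [EuclideanSpace.real_norm_sq_eq, Fin.sum_univ_two]
  have h3 : ‖(-(A y 1)) • EuclideanSpace.single (0 : Fin 2) (1:ℝ) + A y 0 • EuclideanSpace.single (1 : Fin 2) (1:ℝ)‖ ^ 2 = ‖A y‖ ^ 2 := by
    rw [h1, h2]; ring
  exact (sq_eq_sq₀ (norm_nonneg _) (norm_nonneg _)).1 h3

/-! ## §2 `L²` letters for differences of mollified fields -/

/-- `‖u‖_{L²} ≤ ‖u − w‖_{L²} + ‖w − v‖_{L²}`-type bound: `‖M − M'‖₂ ≤ ‖M − a‖₂ + ‖M' − a‖₂`. [folklore] -/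
theorem eLpNorm_sub_le_of_sub {f g a : EuclideanSpace ℝ (Fin 2) → ℝ} (hf : AEStronglyMeasurable f volume)
    (hg : AEStronglyMeasurable g volume) (ha : AEStronglyMeasurable a volume) :
    eLpNorm (f - g) 2 volume ≤ eLpNorm (f - a) 2 volume + eLpNorm (g - a) 2 volume := by
  have h : f - g = (f - a) - (g - a) := by abel
  rw [h]
  exact eLpNorm_sub_le (hf.sub ha) (hg.sub ha) (by norm_num)

/-- The `L²` norm of the differential `a ↦ ⟪(W₀ a, W₁ a), ·⟫` is at most `‖W₀‖₂ + ‖W₁‖₂`. [folklore] -/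
theorem eLpNorm_innerSL_vec2_le {W₀ W₁ : EuclideanSpace ℝ (Fin 2) → ℝ} (h₀ : AEStronglyMeasurable W₀ volume)
    (h₁ : AEStronglyMeasurable W₁ volume) :
    eLpNorm (fun a => innerSL ℝ (W₀ a • EuclideanSpace.single (0 : Fin 2) (1:ℝ) + W₁ a • EuclideanSpace.single (1 : Fin 2) (1:ℝ)))
        2 volume ≤ eLpNorm W₀ 2 volume + eLpNorm W₁ 2 volume := by
  have hpt : ∀ a, ‖innerSL ℝ (W₀ a • EuclideanSpace.single (0 : Fin 2) (1:ℝ) + W₁ a • EuclideanSpace.single (1 : Fin 2) (1:ℝ))‖ ≤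
      ‖((fun a => |W₀ a|) + fun a => |W₁ a|) a‖ := by
    intro a
    rw [innerSL_apply_norm, Pi.add_apply, Real.norm_eq_abs, abs_of_nonneg (by positivity)]
    calc ‖W₀ a • EuclideanSpace.single (0 : Fin 2) (1:ℝ) + W₁ a • EuclideanSpace.single (1 : Fin 2) (1:ℝ)‖
        ≤ ‖W₀ a • EuclideanSpace.single (0 : Fin 2) (1:ℝ)‖ + ‖W₁ a • EuclideanSpace.single (1 : Fin 2) (1:ℝ)‖ := norm_add_le _ _
      _ = |W₀ a| + |W₁ a| := by simp [norm_smul]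
  calc eLpNorm (fun a => innerSL ℝ (W₀ a • EuclideanSpace.single (0 : Fin 2) (1:ℝ) + W₁ a • EuclideanSpace.single (1 : Fin 2) (1:ℝ)))
        2 volume ≤ eLpNorm ((fun a => |W₀ a|) + fun a => |W₁ a|) 2 volume := eLpNorm_mono hpt
    _ ≤ eLpNorm (fun a => |W₀ a|) 2 volume + eLpNorm (fun a => |W₁ a|) 2 volume :=
        eLpNorm_add_le (h₀.norm.congr (by simp)) (h₁.norm.congr (by simp)) (by norm_num)
    _ = eLpNorm W₀ 2 volume + eLpNorm W₁ 2 volume := by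
        congr 1 <;> exact eLpNorm_congr_norm_ae (ae_of_all _ fun a => by simp)

/-! ## §3 Normalised potentials: mean zero on the unit ball, and the Cauchy estimate for their differences -/

/-- Normalising a continuous function by its mean on the unit ball: `∫_{B₁} (f − ⨍_{B₁} f) = 0`. [folklore] -/
theorem setIntegral_unitBall_sub_average_eq_zero {f : EuclideanSpace ℝ (Fin 2) → ℝ} (hf : Continuous f) :
    ∫ y in ball (0 : EuclideanSpace ℝ (Fin 2)) 1, (f y - ⨍ z in ball (0 : EuclideanSpace ℝ (Fin 2)) 1, f z) = 0 := by
  have hv10 : volume (ball (0 : EuclideanSpace ℝ (Fin 2)) 1) ≠ 0 := (measure_ball_pos volume _ one_pos).ne'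
  have hv1t : volume (ball (0 : EuclideanSpace ℝ (Fin 2)) 1) ≠ ⊤ := measure_ball_lt_top.ne
  have hfi : IntegrableOn f (ball (0 : EuclideanSpace ℝ (Fin 2)) 1) volume :=
    (hf.continuousOn.integrableOn_compact (isCompact_closedBall (0 : EuclideanSpace ℝ (Fin 2)) 1)).mono_set ball_subset_closedBall
  have hreal : (volume.real (ball (0 : EuclideanSpace ℝ (Fin 2)) 1)) ≠ 0 := by
    rw [Measure.real, ENNReal.toReal_ne_zero]; exact ⟨hv10, hv1t⟩
  rw [integral_sub hfi (integrableOn_const hv1t), setIntegral_const, setAverage_eq, smul_eq_mul, smul_eq_mul]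
  field_simp
  ring

/-- ★ **THE CAUCHY ESTIMATE FOR NORMALISED POTENTIALS.**  Let `f, f'` be `C¹` potentials of the rotated mollified fields of `A` at two
test kernels `ρ, ρ'` (H1 `exists_potential_mollified_rot`), and normalise both to mean zero on `B₁(0)`.  Then for every `R ≥ 1`
`‖(f − ⨍_{B₁}f) − (f' − ⨍_{B₁}f')‖_{L¹(B_R)} ≤ K_R·(‖ρ ⋆ A₀ − ρ' ⋆ A₀‖_{L²} + ‖ρ ⋆ A₁ − ρ' ⋆ A₁‖_{L²})`, `K_R` the constant of H2
`eLpNorm_one_ball_le`. [cite: Evans2010, §5.8.1 Thm. 1] -/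
theorem eLpNorm_sub_normalised_potentials_le {A : EuclideanSpace ℝ (Fin 2) → EuclideanSpace ℝ (Fin 2)}
    (hA : ∀ k : Fin 2, LocallyIntegrable (fun y => A y k) volume)
    {ρ ρ' : EuclideanSpace ℝ (Fin 2) → ℝ} (hρ : IsTestFunctionOn (⊤ : Opens (EuclideanSpace ℝ (Fin 2))) ρ)
    (hρ' : IsTestFunctionOn (⊤ : Opens (EuclideanSpace ℝ (Fin 2))) ρ')
    {f f' : EuclideanSpace ℝ (Fin 2) → ℝ}
    (hf : ∀ a, HasFDerivAt f (innerSL ℝ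
        ((-(ρ ⋆[lsmul ℝ ℝ, volume] fun y => A y 1) a) • EuclideanSpace.single (0 : Fin 2) (1:ℝ) +
          (ρ ⋆[lsmul ℝ ℝ, volume] fun y => A y 0) a • EuclideanSpace.single (1 : Fin 2) (1:ℝ))) a)
    (hf' : ∀ a, HasFDerivAt f' (innerSL ℝ
        ((-(ρ' ⋆[lsmul ℝ ℝ, volume] fun y => A y 1) a) • EuclideanSpace.single (0 : Fin 2) (1:ℝ) +
          (ρ' ⋆[lsmul ℝ ℝ, volume] fun y => A y 0) a • EuclideanSpace.single (1 : Fin 2) (1:ℝ))) a)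
    {R : ℝ} (hR : 1 ≤ R) :
    eLpNorm ((fun x => f x - ⨍ z in ball (0 : EuclideanSpace ℝ (Fin 2)) 1, f z) -
        fun x => f' x - ⨍ z in ball (0 : EuclideanSpace ℝ (Fin 2)) 1, f' z) 1
        (volume.restrict (ball (0 : EuclideanSpace ℝ (Fin 2)) R)) ≤
      (1 + volume (ball (0 : EuclideanSpace ℝ (Fin 2)) R) * (volume (ball (0 : EuclideanSpace ℝ (Fin 2)) 1))⁻¹) *
        volume (ball (0 : EuclideanSpace ℝ (Fin 2)) R) ^ (1 / 2 : ℝ) * ENNReal.ofReal (4 * R) *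
        (eLpNorm ((ρ ⋆[lsmul ℝ ℝ, volume] fun y => A y 0) - (ρ' ⋆[lsmul ℝ ℝ, volume] fun y => A y 0)) 2 volume +
          eLpNorm ((ρ ⋆[lsmul ℝ ℝ, volume] fun y => A y 1) - (ρ' ⋆[lsmul ℝ ℝ, volume] fun y => A y 1)) 2 volume) := by
  -- abbreviations
  set M₀ : EuclideanSpace ℝ (Fin 2) → ℝ := ρ ⋆[lsmul ℝ ℝ, volume] fun y => A y 0 with hM₀
  set M₁ : EuclideanSpace ℝ (Fin 2) → ℝ := ρ ⋆[lsmul ℝ ℝ, volume] fun y => A y 1 with hM₁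
  set M₀' : EuclideanSpace ℝ (Fin 2) → ℝ := ρ' ⋆[lsmul ℝ ℝ, volume] fun y => A y 0 with hM₀'
  set M₁' : EuclideanSpace ℝ (Fin 2) → ℝ := ρ' ⋆[lsmul ℝ ℝ, volume] fun y => A y 1 with hM₁'
  have hM₀c : ContDiff ℝ 1 M₀ := contDiff_mollify hρ (hA 0)
  have hM₁c : ContDiff ℝ 1 M₁ := contDiff_mollify hρ (hA 1)
  have hM₀'c : ContDiff ℝ 1 M₀' := contDiff_mollify hρ' (hA 0)
  have hM₁'c : ContDiff ℝ 1 M₁' := contDiff_mollify hρ' (hA 1)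
  have hfc : ContDiff ℝ 1 f := (potential_props hM₁c.neg hM₀c hf).1
  have hf'c : ContDiff ℝ 1 f' := (potential_props hM₁'c.neg hM₀'c hf').1
  -- the difference `G` of the normalised potentials
  set c : ℝ := ⨍ z in ball (0 : EuclideanSpace ℝ (Fin 2)) 1, f z with hc
  set c' : ℝ := ⨍ z in ball (0 : EuclideanSpace ℝ (Fin 2)) 1, f' z with hc'
  set G : EuclideanSpace ℝ (Fin 2) → ℝ := (fun x => f x - c) - fun x => f' x - c' with hG
  have hGc : ContDiff ℝ 1 G := (hfc.sub contDiff_const).sub (hf'c.sub contDiff_const)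
  -- `∫_{B₁} G = 0`
  have hG0 : ∫ y in ball (0 : EuclideanSpace ℝ (Fin 2)) 1, G y = 0 := by
    have hv1t : volume (ball (0 : EuclideanSpace ℝ (Fin 2)) 1) ≠ ⊤ := measure_ball_lt_top.ne
    have hi : ∀ {g : EuclideanSpace ℝ (Fin 2) → ℝ}, Continuous g → IntegrableOn g (ball (0 : EuclideanSpace ℝ (Fin 2)) 1) volume :=
      fun hg => (hg.continuousOn.integrableOn_compact (isCompact_closedBall (0 : EuclideanSpace ℝ (Fin 2)) 1)).mono_set
        ball_subset_closedBall
    have h1 := setIntegral_unitBall_sub_average_eq_zero hfc.continuous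
    have h2 := setIntegral_unitBall_sub_average_eq_zero hf'c.continuous
    have hsplit : ∫ y in ball (0 : EuclideanSpace ℝ (Fin 2)) 1, G y =
        (∫ y in ball (0 : EuclideanSpace ℝ (Fin 2)) 1, (f y - c)) - ∫ y in ball (0 : EuclideanSpace ℝ (Fin 2)) 1, (f' y - c') := by
      have hGy : ∀ y, G y = (f y - c) - (f' y - c') := fun y => rfl
      simp_rw [hGy]
      exact integral_sub ((hi hfc.continuous).sub (integrableOn_const hv1t)) ((hi hf'c.continuous).sub (integrableOn_const hv1t))
    rw [hsplit, h1, h2, sub_zero]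
  -- the differential of `G`
  have hGd : ∀ a, HasFDerivAt G (innerSL ℝ ((-(M₁ a - M₁' a)) • EuclideanSpace.single (0 : Fin 2) (1:ℝ) +
      (M₀ a - M₀' a) • EuclideanSpace.single (1 : Fin 2) (1:ℝ))) a := by
    intro a
    have h := ((hf a).sub_const c).sub ((hf' a).sub_const c')
    have heq : innerSL ℝ ((-(M₁ a)) • EuclideanSpace.single (0 : Fin 2) (1:ℝ) + M₀ a • EuclideanSpace.single (1 : Fin 2) (1:ℝ)) -
        innerSL ℝ ((-(M₁' a)) • EuclideanSpace.single (0 : Fin 2) (1:ℝ) + M₀' a • EuclideanSpace.single (1 : Fin 2) (1:ℝ)) =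
        innerSL ℝ ((-(M₁ a - M₁' a)) • EuclideanSpace.single (0 : Fin 2) (1:ℝ) +
          (M₀ a - M₀' a) • EuclideanSpace.single (1 : Fin 2) (1:ℝ)) := by
      rw [← map_sub]
      congr 1
      ext i
      fin_cases i
      all_goals simp
      all_goals ring
    rw [heq] at h
    exact h
  have hGfd : fderiv ℝ G = fun a => innerSL ℝ ((-(M₁ a - M₁' a)) • EuclideanSpace.single (0 : Fin 2) (1:ℝ) +
      (M₀ a - M₀' a) • EuclideanSpace.single (1 : Fin 2) (1:ℝ)) := funext fun a => (hGd a).fderiv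
  -- `‖DG‖_{L²} ≤ ‖ΔM₁‖₂ + ‖ΔM₀‖₂`
  have hM₀m : AEStronglyMeasurable (M₀ - M₀') volume := (hM₀c.continuous.sub hM₀'c.continuous).aestronglyMeasurable
  have hM₁m : AEStronglyMeasurable (M₁ - M₁') volume := (hM₁c.continuous.sub hM₁'c.continuous).aestronglyMeasurable
  have hDG : eLpNorm (fderiv ℝ G) 2 volume ≤ eLpNorm (M₀ - M₀') 2 volume + eLpNorm (M₁ - M₁') 2 volume := by
    rw [hGfd]
    have h := eLpNorm_innerSL_vec2_le (W₀ := fun a => -(M₁ a - M₁' a)) (W₁ := fun a => M₀ a - M₀' a) hM₁m.neg hM₀m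
    have hneg : eLpNorm (fun a => -(M₁ a - M₁' a)) 2 volume = eLpNorm (M₁ - M₁') 2 volume := by
      rw [show (fun a => -(M₁ a - M₁' a)) = -(M₁ - M₁') from rfl, eLpNorm_neg]
    rw [hneg] at h
    calc _ ≤ eLpNorm (M₁ - M₁') 2 volume + eLpNorm (fun a => M₀ a - M₀' a) 2 volume := h
      _ = eLpNorm (M₀ - M₀') 2 volume + eLpNorm (M₁ - M₁') 2 volume := by rw [add_comm]; rfl
  -- H2
  calc eLpNorm G 1 (volume.restrict (ball (0 : EuclideanSpace ℝ (Fin 2)) R))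
      ≤ (1 + volume (ball (0 : EuclideanSpace ℝ (Fin 2)) R) * (volume (ball (0 : EuclideanSpace ℝ (Fin 2)) 1))⁻¹) *
        volume (ball (0 : EuclideanSpace ℝ (Fin 2)) R) ^ (1 / 2 : ℝ) * ENNReal.ofReal (4 * R) *
          eLpNorm (fderiv ℝ G) 2 volume := eLpNorm_one_ball_le hGc hG0 hR
    _ ≤ _ := by gcongr

/-! ## §4 Two `L¹`-convergence letters for the passage to the limit -/

/-- **Bounded compactly supported weight against an `L¹_loc`-convergent sequence**: if `g` is bounded by `C` and vanishes off the
measurable set `s`, and `h_j → h` in `L¹(s)`, then `∫ g·h_j → ∫ g·h` (all products integrable). [folklore] -/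
theorem tendsto_integral_mul_of_eLpNorm_restrict {g : EuclideanSpace ℝ (Fin 2) → ℝ} {s : Set (EuclideanSpace ℝ (Fin 2))}
    (hs : MeasurableSet s) {C : ℝ} (hgC : ∀ x, ‖g x‖ ≤ C) (hgs : ∀ x, x ∉ s → g x = 0)
    {h : ℕ → EuclideanSpace ℝ (Fin 2) → ℝ} {hlim : EuclideanSpace ℝ (Fin 2) → ℝ}
    (hint : ∀ j, Integrable (fun x => g x * h j x) volume) (hlimm : AEStronglyMeasurable (fun x => g x * hlim x) volume)
    (hL1 : Tendsto (fun j => eLpNorm (h j - hlim) 1 (volume.restrict s)) atTop (𝓝 0)) :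
    Tendsto (fun j => ∫ x, g x * h j x) atTop (𝓝 (∫ x, g x * hlim x)) := by
  refine tendsto_integral_of_L1 (fun x => g x * hlim x) hlimm (Eventually.of_forall hint) ?_
  have hC0 : 0 ≤ C := le_trans (norm_nonneg _) (hgC 0)
  -- pointwise: `‖g (h_j − h)‖ₑ ≤ C · 𝟙_s ‖h_j − h‖ₑ`
  have hpt : ∀ j x, ‖g x * h j x - g x * hlim x‖ₑ ≤ ENNReal.ofReal C * s.indicator (fun x => ‖h j x - hlim x‖ₑ) x := by
    intro j x
    rw [← mul_sub, enorm_mul]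
    by_cases hx : x ∈ s
    · rw [indicator_of_mem hx]
      gcongr
      rw [← ofReal_norm]
      exact ENNReal.ofReal_le_ofReal (hgC x)
    · rw [hgs x hx]; simp
  have hbound : ∀ j, ∫⁻ x, ‖g x * h j x - g x * hlim x‖ₑ ≤ ENNReal.ofReal C * eLpNorm (h j - hlim) 1 (volume.restrict s) := by
    intro j
    calc ∫⁻ x, ‖g x * h j x - g x * hlim x‖ₑ ≤ ∫⁻ x, ENNReal.ofReal C * s.indicator (fun x => ‖h j x - hlim x‖ₑ) x :=
          lintegral_mono fun x => hpt j x
      _ = ENNReal.ofReal C * ∫⁻ x in s, ‖h j x - hlim x‖ₑ := by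
          rw [lintegral_const_mul' _ _ ENNReal.ofReal_ne_top, lintegral_indicator hs]
      _ = ENNReal.ofReal C * eLpNorm (h j - hlim) 1 (volume.restrict s) := by
          rw [eLpNorm_one_eq_lintegral_enorm]
          simp only [Pi.sub_apply]
  have hup : Tendsto (fun j => ENNReal.ofReal C * eLpNorm (h j - hlim) 1 (volume.restrict s)) atTop (𝓝 0) := by
    have := ENNReal.Tendsto.const_mul (a := ENNReal.ofReal C) hL1 (Or.inr ENNReal.ofReal_ne_top)
    rwa [mul_zero] at this
  exact tendsto_of_tendsto_of_tendsto_of_le_of_le tendsto_const_nhds hup (fun j => zero_le) hbound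

/-- **An `L²` weight against an `L²`-convergent sequence**: if `η ∈ L²` and `u_j → u` in `L²`, then `∫ η·u_j → ∫ η·u` (Hölder with
exponents `(2, 2, 1)`; all products integrable). [folklore] -/
theorem tendsto_integral_mul_of_eLpNorm_two {η : EuclideanSpace ℝ (Fin 2) → ℝ} (hηm : AEStronglyMeasurable η volume)
    (hη2 : eLpNorm η 2 volume ≠ ⊤) {u : ℕ → EuclideanSpace ℝ (Fin 2) → ℝ} {ulim : EuclideanSpace ℝ (Fin 2) → ℝ}
    (hum : ∀ j, AEStronglyMeasurable (u j) volume) (hulimm : AEStronglyMeasurable ulim volume)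
    (hint : ∀ j, Integrable (fun x => η x * u j x) volume)
    (hL2 : Tendsto (fun j => eLpNorm (u j - ulim) 2 volume) atTop (𝓝 0)) :
    Tendsto (fun j => ∫ x, η x * u j x) atTop (𝓝 (∫ x, η x * ulim x)) := by
  refine tendsto_integral_of_L1 (fun x => η x * ulim x) (hηm.mul hulimm) (Eventually.of_forall hint) ?_
  have hbound : ∀ j, ∫⁻ x, ‖η x * u j x - η x * ulim x‖ₑ ≤ eLpNorm η 2 volume * eLpNorm (u j - ulim) 2 volume := by
    intro j
    have h := eLpNorm_smul_le_mul_eLpNorm (p := 2) (q := 2) (r := 1) ((hum j).sub hulimm) hηm (μ := volume)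
    rw [eLpNorm_one_eq_lintegral_enorm] at h
    refine le_trans (le_of_eq ?_) h
    refine lintegral_congr fun x => ?_
    simp only [Pi.smul_apply', Pi.sub_apply, smul_eq_mul, mul_sub]
  have hup : Tendsto (fun j => eLpNorm η 2 volume * eLpNorm (u j - ulim) 2 volume) atTop (𝓝 0) := by
    have := ENNReal.Tendsto.const_mul (a := eLpNorm η 2 volume) hL2 (Or.inr hη2)
    rwa [mul_zero] at this
  exact tendsto_of_tendsto_of_tendsto_of_le_of_le tendsto_const_nhds hup (fun j => zero_le) hbound

end Summit.QuantumFields.YangMills.Theorems.PoincareLipschitzPlanarStreamFunctionLimitLetters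

end
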